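import Summits.AnomalousDissipation.AnomalousDissipation.Theorems.SolenoidalFractalHomogenisationLagrangianStepCellLawVQSOddEvenKernel
import HarnessLib

/-!
# K1L `LagrangianRenormalisationStep(Design)` (K1L_D, stmt-AnomalousDissipation-27980), stub `stub_cellLawV0_IS`, IS-half obligation
# `stub_W_evenSlackB`, analytic stub S2 «odd/even comparison» — PART 3/3: **`oddEven_qsResp`** = p5 g12's `stub_oddEven`
# `|vᵀ f_T(B) v − vᵀ f_T(½(B + Bᵀ)) v| ≤ (ω²/b³)|v|²` (helper; `--supports … --as helper`; word-independent)

Summits-side helper file of route `SolenoidalFractalHomogenisation` (prover seat `ad-sawtooth-k1loc-p1` g12; planner ad-ideate-p5 g12's even certificate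
`Lines/onelevel_W_evenSlack_cert.lean`, v2 cut 2026-08-29T00:02:52Z).  THE displayed signature of `stub_oddEven`: for every real `3 × 3` block `B`,
`0 < b`, `b|w|² ≤ wᵀBw` (all `w`), `(uᵀBw − wᵀBu)² ≤ 4ω²|u|²|w|²` (all `u, w`), `0 ≤ T`, every ramp `ρ` and every `v`:
`|vᵀ qsResp ρ T B v − vᵀ qsResp ρ T (½(B + Bᵀ)) v| ≤ (ω²/b³)·|v|²` — in the double-sum currency (`oddEven_qsResp`) and in the `⬝ᵥ`/`*ᵥ` currency
(`oddEven_qsResp'`).  Proof: the kernel comparison of part 2, `|vᵀe^{−τB}v − vᵀe^{−τB_s}v| ≤ (ω²/2)τ²e^{−bτ}|v|²`, integrated against the slot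
weights `0 ≤ a ≤ 1` with `∫₀ˢ (s−x)²e^{−c(s−x)}dx = 2/c³ − e^{−cs}(s²/c + 2s/c² + 2/c³) ≤ 2/c³`, `c = bT` (`integral_sq_mul_exp_neg_le`).  The constant
is the CRUDE one of the cut (kernel mass `2/b³`, no `ϑ″`).  Everything PROVED, no definition, no named fact, no sorry.  Infrastructure for rung leaf
F-D1.A0; NOT a proof of the stub `stub_cellLawV0_IS`, of the crux, of Onsager's conjecture or of anomalous dissipation.
-/

set_option linter.dupNamespace false

noncomputable section

namespace Summit.AnomalousDissipation.AnomalousDissipation.Theorems.SolenoidalFractalHomogenisation.LagrangianStep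

open Literature.Analysis Literature.Analysis.FluidPDE Literature.Analysis.FunctionSpaces
open Literature.Analysis.ODE.PeriodicAveraging
open MeasureTheory Set Real Matrix

section Integration

/-- `∫₀ˢ (s − x)² e^{−c(s−x)} dx ≤ 2/c³` for `c > 0`, `s ≥ 0` (explicit antiderivative; the value is `2/c³ − e^{−cs}(s²/c + 2s/c² + 2/c³)`). [folklore] -/
theorem integral_sq_mul_exp_neg_le {c s : ℝ} (hc : 0 < c) (hs : 0 ≤ s) :
    ∫ x in (0:ℝ)..s, (s - x) ^ 2 * Real.exp (-(c * (s - x))) ≤ 2 / c ^ 3 := by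
  have hc0 : c ≠ 0 := hc.ne'
  have hF : ∀ x ∈ uIcc (0:ℝ) s, HasDerivAt (fun y => Real.exp (-(c * (s - y))) * ((s - y) ^ 2 / c + 2 * (s - y) / c ^ 2 + 2 / c ^ 3))
      ((s - x) ^ 2 * Real.exp (-(c * (s - x)))) x := by
    intro x _
    have h1 : HasDerivAt (fun y => Real.exp (-(c * (s - y)))) (Real.exp (-(c * (s - x))) * c) x := by
      have hi : HasDerivAt (fun y => -(c * (s - y))) c x := by
        have h := ((hasDerivAt_id x).const_mul c).sub_const (c * s)
        have e : (fun y => -(c * (s - y))) = fun y => c * id y - c * s := by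
          funext y; simp only [id]; ring
        rw [e]
        simpa using h
      exact hi.exp
    have h2 : HasDerivAt (fun y => (s - y) ^ 2 / c + 2 * (s - y) / c ^ 2 + 2 / c ^ 3)
        (-(2 * (s - x)) / c + -2 / c ^ 2) x := by
      have hlin : HasDerivAt (fun y => s - y) (-1) x := by
        simpa using (hasDerivAt_id x).const_sub s
      have ha := (hlin.fun_pow 2).div_const c
      have hb := (hlin.const_mul 2).div_const (c ^ 2)
      have h := (ha.add hb).add_const (2 / c ^ 3)
      refine h.congr_deriv ?_
      simp only [Nat.cast_ofNat, Nat.add_one_sub_one, pow_one, mul_neg, mul_one]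
    refine (h1.mul h2).congr_deriv ?_
    field_simp
    ring
  rw [intervalIntegral.integral_eq_sub_of_hasDerivAt hF ((by fun_prop : Continuous fun x : ℝ =>
    (s - x) ^ 2 * Real.exp (-(c * (s - x)))).intervalIntegrable _ _)]
  simp only [sub_self, mul_zero, neg_zero, Real.exp_zero, one_mul, ne_eq, OfNat.ofNat_ne_zero, not_false_eq_true,
    zero_pow, zero_div, zero_add, sub_zero]
  have hpos : 0 ≤ Real.exp (-(c * s)) * (s ^ 2 / c + 2 * s / c ^ 2 + 2 / c ^ 3) := by positivity
  linarith

variable (B : Matrix (Fin 3) (Fin 3) ℝ) (v : Fin 3 → ℝ)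

/-- **S2 `stub_oddEven` (double-sum currency).**  `0 < b`, `b|w|² ≤ wᵀBw`, `(uᵀBw − wᵀBu)² ≤ 4ω²|u|²|w|²`, `0 ≤ T` ⟹
`|vᵀ f_T(B) v − vᵀ f_T(½(B + Bᵀ)) v| ≤ (ω²/b³)·|v|²`, `f_T = qsResp ρ T`. [folklore] -/
theorem oddEven_qsResp {b ω : ℝ} (hb0 : 0 < b) (hb : ∀ w : Fin 3 → ℝ, b * ∑ i, w i ^ 2 ≤ ∑ i, ∑ j, w i * B i j * w j)
    (hω : ∀ u w : Fin 3 → ℝ, (∑ i, ∑ j, u i * B i j * w j - ∑ i, ∑ j, w i * B i j * u j) ^ 2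
      ≤ 4 * ω ^ 2 * (∑ i, u i ^ 2) * (∑ i, w i ^ 2)) (ρ : ℝ) {T : ℝ} (hT : 0 ≤ T) :
    |∑ i, ∑ j, v i * qsResp ρ T B i j * v j - ∑ i, ∑ j, v i * qsResp ρ T ((1 / 2 : ℝ) • (B + Bᵀ)) i j * v j|
      ≤ ω ^ 2 / b ^ 3 * ∑ i, v i ^ 2 := by
  set Bs := (1 / 2 : ℝ) • (B + Bᵀ) with hBs
  set V := ∑ i, v i ^ 2 with hV
  have hV0 : 0 ≤ V := Finset.sum_nonneg fun i _ => sq_nonneg _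
  rcases hT.eq_or_lt with hT0 | hTpos
  · -- `T = 0`: both responses vanish
    have hz : ∀ M : Matrix (Fin 3) (Fin 3) ℝ, ∑ i, ∑ j, v i * qsResp ρ T M i j * v j = 0 := fun M => by
      rw [sum_sum_mul_qsResp_mul, ← hT0, zero_mul]
    rw [hz, hz, sub_self, abs_zero]; positivity
  set α : ℝ → ℝ := fun s => LatticeShear.LatticeWord.trapezoid 0 1 ρ s with hα
  have hαc : Continuous α := continuous_trapezoid_unit ρ
  have hα01 : ∀ s, 0 ≤ α s ∧ α s ≤ 1 := fun s => by
    refine ⟨trapezoid_unit_nonneg ρ s, ?_⟩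
    show max 0 (min 1 _) ≤ 1
    exact max_le zero_le_one (min_le_left _ _)
  -- the two kernels and their difference
  set KB : ℝ → ℝ → ℝ := fun s x => ∑ i, ∑ j, v i * (NormedSpace.exp (-(T * (s - x)) • B)) i j * v j with hKB
  set KS : ℝ → ℝ → ℝ := fun s x => ∑ i, ∑ j, v i * (NormedSpace.exp (-(T * (s - x)) • Bs)) i j * v j with hKS
  have hKBc : Continuous (Function.uncurry KB) := continuous_qsKernel_bilin T B v v
  have hKSc : Continuous (Function.uncurry KS) := continuous_qsKernel_bilin T Bs v v
  have hD : ∀ s x, x ≤ s → |KB s x - KS s x| ≤ ω ^ 2 / 2 * (T * (s - x)) ^ 2 * Real.exp (-(b * (T * (s - x)))) * V := by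
    intro s x hxs
    have hτ : 0 ≤ T * (s - x) := mul_nonneg hT (by linarith)
    have h := abs_form_exp_sub_form_exp_symm_le B v hb hω hτ
    rw [hKB, hKS]
    simp only
    rw [neg_smul, neg_smul, ← sum_mul_mulVec_eq_sum_sum, ← sum_mul_mulVec_eq_sum_sum]
    exact h
  -- the inner integral
  have hin_int : ∀ (K : ℝ → ℝ → ℝ), Continuous (Function.uncurry K) → ∀ s,
      IntervalIntegrable (fun x => α x * K s x) volume 0 s := fun K hK s =>
    (hαc.mul (hK.comp (continuous_const.prodMk continuous_id))).intervalIntegrable _ _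
  have hout_cont : ∀ (K : ℝ → ℝ → ℝ), Continuous (Function.uncurry K) →
      Continuous fun s => α s * ∫ x in (0:ℝ)..s, α x * K s x := by
    intro K hK
    have hf : Continuous (Function.uncurry fun s x : ℝ => α x * K s x) := (hαc.comp continuous_snd).mul hK
    exact hαc.mul (intervalIntegral.continuous_parametric_intervalIntegral_of_continuous (a₀ := 0) hf continuous_id)
  have hinner : ∀ s, 0 ≤ s → |∫ x in (0:ℝ)..s, α x * (KB s x - KS s x)| ≤ ω ^ 2 * V / (b ^ 3 * T) := by
    intro s hs
    have hbT : 0 < b * T := mul_pos hb0 hTpos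
    have h1 : |∫ x in (0:ℝ)..s, α x * (KB s x - KS s x)|
        ≤ ∫ x in (0:ℝ)..s, ω ^ 2 / 2 * V * T ^ 2 * ((s - x) ^ 2 * Real.exp (-(b * T * (s - x)))) := by
      rw [← Real.norm_eq_abs]
      refine intervalIntegral.norm_integral_le_of_norm_le hs (Filter.Eventually.of_forall fun x hx => ?_) ?_
      · rw [Real.norm_eq_abs, abs_mul, abs_of_nonneg (hα01 x).1]
        have hd := hD s x hx.2
        calc α x * |KB s x - KS s x| ≤ 1 * (ω ^ 2 / 2 * (T * (s - x)) ^ 2 * Real.exp (-(b * (T * (s - x)))) * V) :=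
              mul_le_mul (hα01 x).2 hd (abs_nonneg _) zero_le_one
          _ = _ := by rw [one_mul]; ring_nf
      · exact (by fun_prop : Continuous fun x : ℝ => ω ^ 2 / 2 * V * T ^ 2 * ((s - x) ^ 2 * Real.exp (-(b * T * (s - x))))).intervalIntegrable _ _
    refine h1.trans ?_
    rw [intervalIntegral.integral_const_mul]
    have h2 := integral_sq_mul_exp_neg_le hbT hs
    calc ω ^ 2 / 2 * V * T ^ 2 * ∫ x in (0:ℝ)..s, (s - x) ^ 2 * Real.exp (-(b * T * (s - x)))
        ≤ ω ^ 2 / 2 * V * T ^ 2 * (2 / (b * T) ^ 3) := mul_le_mul_of_nonneg_left h2 (by positivity)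
      _ = ω ^ 2 * V / (b ^ 3 * T) := by field_simp
  -- the difference of the two responses as one double integral
  have hdiff : ∑ i, ∑ j, v i * qsResp ρ T B i j * v j - ∑ i, ∑ j, v i * qsResp ρ T Bs i j * v j
      = T * ∫ s in (0:ℝ)..1, α s * ∫ x in (0:ℝ)..s, α x * (KB s x - KS s x) := by
    rw [sum_sum_mul_qsResp_mul, sum_sum_mul_qsResp_mul, ← mul_sub, ← intervalIntegral.integral_sub
      ((hout_cont KB hKBc).intervalIntegrable _ _) ((hout_cont KS hKSc).intervalIntegrable _ _)]
    congr 1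
    refine intervalIntegral.integral_congr fun s _ => ?_
    rw [← mul_sub, ← intervalIntegral.integral_sub (hin_int KB hKBc s) (hin_int KS hKSc s)]
    congr 1
    refine intervalIntegral.integral_congr fun x _ => ?_
    simp only [hKB, hKS]
    ring
  rw [hdiff]
  -- the outer integral
  have hJc : Continuous fun s => α s * ∫ x in (0:ℝ)..s, α x * (KB s x - KS s x) := by
    have hf : Continuous (Function.uncurry fun s x : ℝ => α x * (KB s x - KS s x)) :=
      (hαc.comp continuous_snd).mul (hKBc.sub hKSc)
    exact hαc.mul (intervalIntegral.continuous_parametric_intervalIntegral_of_continuous (a₀ := 0) hf continuous_id)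
  have h3 : |∫ s in (0:ℝ)..1, α s * ∫ x in (0:ℝ)..s, α x * (KB s x - KS s x)| ≤ ∫ s in (0:ℝ)..1, ω ^ 2 * V / (b ^ 3 * T) := by
    rw [← Real.norm_eq_abs]
    refine intervalIntegral.norm_integral_le_of_norm_le zero_le_one (Filter.Eventually.of_forall fun s hs => ?_)
      intervalIntegrable_const
    rw [Real.norm_eq_abs, abs_mul, abs_of_nonneg (hα01 s).1]
    calc α s * |∫ x in (0:ℝ)..s, α x * (KB s x - KS s x)| ≤ 1 * (ω ^ 2 * V / (b ^ 3 * T)) :=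
          mul_le_mul (hα01 s).2 (hinner s hs.1.le) (abs_nonneg _) zero_le_one
      _ = _ := one_mul _
  rw [intervalIntegral.integral_const, sub_zero, smul_eq_mul, one_mul] at h3
  rw [abs_mul, abs_of_pos hTpos]
  calc T * |∫ s in (0:ℝ)..1, α s * ∫ x in (0:ℝ)..s, α x * (KB s x - KS s x)| ≤ T * (ω ^ 2 * V / (b ^ 3 * T)) :=
        mul_le_mul_of_nonneg_left h3 hT
    _ = ω ^ 2 / b ^ 3 * V := by field_simp

/-- **S2 `stub_oddEven` (`⬝ᵥ`/`*ᵥ` currency).**  Same statement with `x ⬝ᵥ M *ᵥ x` and `x ⬝ᵥ x`. [folklore] -/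
theorem oddEven_qsResp' {b ω : ℝ} (hb0 : 0 < b) (hb : ∀ w : Fin 3 → ℝ, b * (w ⬝ᵥ w) ≤ w ⬝ᵥ B *ᵥ w)
    (hω : ∀ u w : Fin 3 → ℝ, (u ⬝ᵥ B *ᵥ w - w ⬝ᵥ B *ᵥ u) ^ 2 ≤ 4 * ω ^ 2 * (u ⬝ᵥ u) * (w ⬝ᵥ w))
    (ρ : ℝ) {T : ℝ} (hT : 0 ≤ T) :
    |v ⬝ᵥ (qsResp ρ T B) *ᵥ v - v ⬝ᵥ (qsResp ρ T ((1 / 2 : ℝ) • (B + Bᵀ))) *ᵥ v| ≤ ω ^ 2 / b ^ 3 * (v ⬝ᵥ v) := by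
  have hdot : ∀ x y : Fin 3 → ℝ, x ⬝ᵥ y = ∑ i, x i * y i := fun x y => rfl
  have hsq : ∀ x : Fin 3 → ℝ, x ⬝ᵥ x = ∑ i, x i ^ 2 := fun x => by
    rw [hdot]; exact Finset.sum_congr rfl fun i _ => by rw [sq]
  have hform : ∀ (M : Matrix (Fin 3) (Fin 3) ℝ) (x y : Fin 3 → ℝ), x ⬝ᵥ M *ᵥ y = ∑ i, ∑ j, x i * M i j * y j :=
    fun M x y => by rw [hdot, sum_mul_mulVec_eq_sum_sum]
  have hb' : ∀ w : Fin 3 → ℝ, b * ∑ i, w i ^ 2 ≤ ∑ i, ∑ j, w i * B i j * w j := fun w => by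
    rw [← hsq, ← hform]; exact hb w
  have hω' : ∀ u w : Fin 3 → ℝ, (∑ i, ∑ j, u i * B i j * w j - ∑ i, ∑ j, w i * B i j * u j) ^ 2
      ≤ 4 * ω ^ 2 * (∑ i, u i ^ 2) * (∑ i, w i ^ 2) := fun u w => by
    rw [← hsq, ← hsq, ← hform, ← hform]; exact hω u w
  rw [hform, hform, hsq]
  exact oddEven_qsResp B v hb0 hb' hω' ρ hT

end Integration

end Summit.AnomalousDissipation.AnomalousDissipation.Theorems.SolenoidalFractalHomogenisation.LagrangianStep
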